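import Summits.AnomalousDissipation.AnomalousDissipation.Cruxes.MirrorMeanBoundedFamilyTG.CensusSketch
import Summits.AnomalousDissipation.AnomalousDissipation.Cruxes.MirrorMeanBoundedFamilyTG.SketchIdeator2
import Summits.AnomalousDissipation.AnomalousDissipation.Theorems.MirrorEnsembleFloorTransferOnSupport
import Literature.Analysis.FluidPDE.LongTimeAverageNonneg

/-!
# STRATEGY CENSUS, Part II — typed companion (crux `MirrorEnsemble.MirrorMeanBoundedFamilyTG` = B_K, stmt-AnomalousDissipation-17694)

Crux-strategist seat `planner-cstrat-stmt-AnomalousDissipation-17694-r1-0` (REDIRECT second opinion, 2026-08-17).  Prose lives in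
`STRATEGY-CENSUS.md` (v2, Part II).  This file TYPES the Part-II attempts and PROVES the cheap implications, on top of Part I's
`CensusSketch.lean` (strategist b1: `B`, `X`, `IsKFamily`, `crux_iff`, `crux_of_target`, `perViscosity_ceiling`, …) and of ideator 2's
`SketchIdeator2.lean` (`SteadyMirrorBranchTG`, `crux_of_steadyBranch`, `mirrorSet`).  `sorry`-free; nothing here closes the item.

* §0  the restated `B`, `X` of Part I ARE the route decls (`Iff.rfl`), `L` := the route's other crux `MirrorStatisticsLoudTG` by name.
* §1  `summit_of_target : X → AnomalousDissipation` (f_TG is admissible: landed `isSmooth/isDivFree/hasZeroMean_tgForce`).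
* §2  THE DICHOTOMY (route-relative summit strength).  `QuietBoundedMirrorFamilyTG` (a B-witness family whose mean dissipations
      are not bounded away from `0`); `crux_iff_target_or_quiet : B ↔ X ∨ Quiet` (excluded middle on a dissipation floor + index shift);
      `not_loud_of_quiet : Quiet → ¬ L` through the route's OWN landed seam `floorTransferOnSupport_proof`; hence
      `crux_iff_target_of_loud : L → (B ↔ X)`, `crux_cases : B → X ∨ (Quiet ∧ ¬ L)`, `summit_or_not_loud : B → AnomalousDissipation ∨ ¬ L`.
      Inside route MirrorEnsemble, B_K is the target X_K conditioned on the rank-2 crux, and every non-summit proof of B_K kills L_K.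
* §3  STEADY WITNESSES (the free datum).  `steadyStatesDiverge_of_not_crux : ¬ B → SteadyMirrorStatesDivergeTG` (the steady necessary
      condition of any disproof — contradicted in trend by the bounded symmetric steady states of the item's kit evidence);
      the INJECTION SPLIT `SteadyInjectionBoundedTG W₀ → SteadyQuietWarmRigidityTG W₀ Φ → SteadyMirrorBranchTG` (glue proved; the
      rigidity leaf is FALSE at every Galerkin order — two-mode chain — see the census §D6).
* §4  THE EXPONENT LADDER.  `ExponentBoundedMirrorFamily α`; `crux_iff_exponent_zero`, `exponent_mono`, `exponent_two` (top rung
      = Part I's per-viscosity ceiling along `ν_j = 1/(j+1)`).  No rung `α < 2` is known (census §S10).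
-/

set_option linter.dupNamespace false

noncomputable section

open MeasureTheory Filter Topology Set Function UnitAddTorus
open scoped InnerProductSpace ENNReal
open Literature.Analysis.FunctionSpaces Literature.Analysis.FunctionSpaces.Torus
open Literature.Analysis.FluidPDE Literature.Analysis.FluidPDE.Torus

namespace Summit.AnomalousDissipation.AnomalousDissipation.Cruxes.MirrorMeanBoundedFamilyTG.StrategyCensusR1

open Summit.AnomalousDissipation.AnomalousDissipation.Theorems
open Summit.AnomalousDissipation.AnomalousDissipation.Theorems.TaylorGreenLoudGalerkinStates.Negative
open Summit.AnomalousDissipation.AnomalousDissipation.Cruxes.MirrorMeanBoundedFamilyTG.StrategyCensus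

/-! ## §0 Names -/

/-- Part I's restated `B` IS the route decl (both unfold to the same term). -/
theorem B_iff_route :
    B ↔ Summit.AnomalousDissipation.AnomalousDissipation.Theses.MirrorEnsemble.MirrorMeanBoundedFamilyTG :=
  Iff.rfl

/-- Part I's restated `X` IS the route's target decl. -/
theorem X_iff_route :
    X ↔ Summit.AnomalousDissipation.AnomalousDissipation.Theses.MirrorEnsemble.MirrorMeanZerothLawTG :=
  Iff.rfl

/-- The route's rank-2 crux L_K (K-supported bounded statistics are loud), BY NAME. -/
abbrev L : Prop := Summit.AnomalousDissipation.AnomalousDissipation.Theses.MirrorEnsemble.MirrorStatisticsLoudTG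

/-- Index shift of a `K`-family (drop the first `J` members). -/
theorem isKFamily_shift {ν : ℕ → ℝ} {u₀ : ℕ → UnitAddTorus (Fin 3) → EuclideanSpace ℝ (Fin 3)}
    {u : ℕ → ℝ → UnitAddTorus (Fin 3) → EuclideanSpace ℝ (Fin 3)} {U : ℕ → ℝ → energySpace (Fin 3)}
    (h : IsKFamily ν u₀ u U) (J : ℕ) :
    IsKFamily (fun j => ν (j + J)) (fun j => u₀ (j + J)) (fun j => u (j + J)) (fun j => U (j + J)) := by
  obtain ⟨hν, hν0, hLH, hU, hK⟩ := h
  exact ⟨fun j => hν (j + J), hν0.comp (tendsto_add_atTop_nat J), fun j => hLH (j + J), fun j => hU (j + J),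
    fun j => hK (j + J)⟩

/-! ## §1 The target implies the summit -/

/-- **X_K → AnomalousDissipation**: the pinned Taylor–Green force is an admissible force of the Statement
(`isSmooth_tgForce`, `isDivFree_tgForce`, `hasZeroMean_tgForce`, landed), so the route's target is the zeroth law witnessed at `f_TG`. -/
theorem summit_of_target (h : X) : _root_.AnomalousDissipation := by
  obtain ⟨E, ε, hε, ν, u₀, u, U, hν, hν0, hLH, -, -, hE, hD⟩ := h tgForce tgForce_eq
  exact ⟨tgForce, isSmooth_tgForce, isDivFree_tgForce, hasZeroMean_tgForce, ν, u₀, u, hν, hν0, hLH, ⟨E, hE⟩, ε, hε, hD⟩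

/-! ## §2 The loud/quiet dichotomy -/

/-- **Quiet bounded mirror family**: a B_K-witness family (frame `IsKFamily`, mean energies `≤ E`) whose mean dissipations are NOT
bounded away from zero (`liminf_j meanDissipation = 0`).  The only kind of B_K-witness that is not an X_K-witness. -/
def QuietBoundedMirrorFamilyTG : Prop :=
  ∃ (E : ℝ) (ν : ℕ → ℝ) (u₀ : ℕ → UnitAddTorus (Fin 3) → EuclideanSpace ℝ (Fin 3))
    (u : ℕ → ℝ → UnitAddTorus (Fin 3) → EuclideanSpace ℝ (Fin 3)) (U : ℕ → ℝ → energySpace (Fin 3)),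
    IsKFamily ν u₀ u U ∧ (∀ j, meanEnergy (u j) ≤ E) ∧
      ∀ ε : ℝ, 0 < ε → ∀ J : ℕ, ∃ j, J ≤ j ∧ meanDissipation (ν j) (u j) < ε

/-- A quiet bounded family is in particular a B_K-witness. -/
theorem crux_of_quiet (h : QuietBoundedMirrorFamilyTG) : B := by
  obtain ⟨E, ν, u₀, u, U, hfam, hE, -⟩ := h
  exact crux_iff.2 ⟨E, ν, u₀, u, U, hfam, hE⟩

/-- **B_K ↔ X_K ∨ Quiet** (excluded middle on "the mean dissipations are eventually bounded below"; in the first case drop the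
first `J` members of the family). -/
theorem crux_iff_target_or_quiet : B ↔ X ∨ QuietBoundedMirrorFamilyTG := by
  constructor
  · intro hB
    obtain ⟨E, ν, u₀, u, U, hfam, hE⟩ := crux_iff.1 hB
    by_cases hfloor : ∃ ε : ℝ, 0 < ε ∧ ∃ J : ℕ, ∀ j, J ≤ j → ε ≤ meanDissipation (ν j) (u j)
    · left
      obtain ⟨ε, hε, J, hJ⟩ := hfloor
      obtain ⟨hν, hν0, hLH, hU, hK⟩ := isKFamily_shift hfam J
      intro f hf
      have hfg : f = tgForce := hf.trans tgForce_eq.symm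
      subst hfg
      exact ⟨E, ε, hε, fun j => ν (j + J), fun j => u₀ (j + J), fun j => u (j + J), fun j => U (j + J), hν, hν0, hLH,
        hU, hK, fun j => hE (j + J), fun j => hJ (j + J) (Nat.le_add_left J j)⟩
    · right
      push_neg at hfloor
      refine ⟨E, ν, u₀, u, U, hfam, hE, fun ε hε J => ?_⟩
      obtain ⟨j, hJj, hj⟩ := hfloor ε hε J
      exact ⟨j, hJj, hj⟩
  · rintro (hX | hQ)
    · exact crux_of_target hX
    · exact crux_of_quiet hQ

/-- **Quiet → ¬L_K**, through the route's own landed seam `floorTransferOnSupport_proof` (item 17696): if K-supported bounded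
statistics were loud below `ν₀(E)`, every member of the family with `ν_j < ν₀` would have `meanDissipation ≥ ε₀` — but the family
is quiet. -/
theorem not_loud_of_quiet (hQ : QuietBoundedMirrorFamilyTG) : ¬ L := by
  intro hL
  obtain ⟨E, ν, u₀, u, U, ⟨hν, hν0, hLH, hU, hK⟩, hE, hq⟩ := hQ
  obtain ⟨ε₀, ν₀, hε₀, hν₀, hloud⟩ := hL tgForce tgForce_eq E
  obtain ⟨J, hJ⟩ := Filter.eventually_atTop.1 (hν0.eventually (gt_mem_nhds hν₀))
  obtain ⟨j, hJj, hj⟩ := hq ε₀ hε₀ J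
  have key : ε₀ ≤ meanDissipation (ν j) (u j) :=
    floorTransferOnSupport_proof (ν j) E ε₀ tgForce (u₀ j) (u j) (U j)
      {v : energySpace (Fin 3) | ∀ i i' : Fin 3, (fun x => ((v : Lp (EuclideanSpace ℝ (Fin 3)) 2
          (volume : Measure (UnitAddTorus (Fin 3)))) : UnitAddTorus (Fin 3) → EuclideanSpace ℝ (Fin 3))
          (Function.update x i (-x i)) i') =ᵐ[volume]
        (fun x => if i' = i then -(((v : Lp (EuclideanSpace ℝ (Fin 3)) 2 (volume : Measure (UnitAddTorus (Fin 3)))) :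
          UnitAddTorus (Fin 3) → EuclideanSpace ℝ (Fin 3)) x i') else ((v : Lp (EuclideanSpace ℝ (Fin 3)) 2
            (volume : Measure (UnitAddTorus (Fin 3)))) : UnitAddTorus (Fin 3) → EuclideanSpace ℝ (Fin 3)) x i')}
      (hν j) isSmooth_tgForce (hloud (ν j) (hν j) (hJ j hJj)) (hLH j) (hU j) (fun t ht => hK j t ht) (hE j)
  linarith

/-- **Given L_K, B_K is EQUIVALENT to the route's target X_K.** -/
theorem crux_iff_target_of_loud (hL : L) : B ↔ X :=
  ⟨fun hB => (crux_iff_target_or_quiet.1 hB).elim id fun hQ => absurd hL (not_loud_of_quiet hQ), crux_of_target⟩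

/-- **Cases of any B_K-witness**: an X_K-witness, or a quiet family that refutes L_K. -/
theorem crux_cases (hB : B) : X ∨ (QuietBoundedMirrorFamilyTG ∧ ¬ L) :=
  (crux_iff_target_or_quiet.1 hB).imp id fun hQ => ⟨hQ, not_loud_of_quiet hQ⟩

/-- **Route-relative summit strength**: every proof of B_K proves the summit or refutes the route's other crux. -/
theorem summit_or_not_loud (hB : B) : _root_.AnomalousDissipation ∨ ¬ L :=
  (crux_cases hB).imp summit_of_target And.right

/-! ## §3 Steady witnesses (the free datum) -/

/-- Ideator 2's transfer re-exported on Part I's `B`: a bounded branch of steady mirror states gives B_K. -/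
theorem crux_of_steadyBranch' (h : Ideator2.SteadyMirrorBranchTG) : B :=
  Ideator2.crux_of_steadyBranch h

/-- **Steady necessary condition of a disproof.**  For every level `E` there is `ν₀ > 0` below which EVERY steady weak mirror
state `v ∈ V ∩ Fix K` of NS_ν(f_TG) with the energy equation has `∫|v|² > E`. -/
def SteadyMirrorStatesDivergeTG : Prop :=
  ∀ E : ℝ, ∃ ν₀ : ℝ, 0 < ν₀ ∧ ∀ ν : ℝ, 0 < ν → ν < ν₀ → ∀ v : energySpace (Fin 3),
    ((v : Lp (EuclideanSpace ℝ (Fin 3)) 2 (volume : Measure (UnitAddTorus (Fin 3)))) ∈ energySpaceV (Fin 3)) →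
    IsSteadyWeakSolution ν tgForce v →
    ν * (eGradNormSq ((v : Lp (EuclideanSpace ℝ (Fin 3)) 2 (volume : Measure (UnitAddTorus (Fin 3)))) :
        UnitAddTorus (Fin 3) → EuclideanSpace ℝ (Fin 3))).toReal =
      pairing (v : Lp (EuclideanSpace ℝ (Fin 3)) 2 (volume : Measure (UnitAddTorus (Fin 3)))) tgForce →
    v ∈ Ideator2.mirrorSet →
    E < ∫ x, ‖((v : Lp (EuclideanSpace ℝ (Fin 3)) 2 (volume : Measure (UnitAddTorus (Fin 3)))) :
        UnitAddTorus (Fin 3) → EuclideanSpace ℝ (Fin 3)) x‖ ^ 2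

/-- **¬B_K → steady mirror states diverge** (contrapositive of the steady transfer: pick one bounded steady mirror state below each
`ν₀ = 1/(j+1)`; the constant paths are a B_K-witness). -/
theorem steadyStatesDiverge_of_not_crux (hB : ¬ B) : SteadyMirrorStatesDivergeTG := by
  intro E
  by_contra h
  push_neg at h
  have hch : ∀ j : ℕ, ∃ ν : ℝ, 0 < ν ∧ ν < 1 / ((j : ℝ) + 1) ∧ ∃ v : energySpace (Fin 3),
      ((v : Lp (EuclideanSpace ℝ (Fin 3)) 2 (volume : Measure (UnitAddTorus (Fin 3)))) ∈ energySpaceV (Fin 3)) ∧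
      IsSteadyWeakSolution ν tgForce v ∧
      ν * (eGradNormSq ((v : Lp (EuclideanSpace ℝ (Fin 3)) 2 (volume : Measure (UnitAddTorus (Fin 3)))) :
          UnitAddTorus (Fin 3) → EuclideanSpace ℝ (Fin 3))).toReal =
        pairing (v : Lp (EuclideanSpace ℝ (Fin 3)) 2 (volume : Measure (UnitAddTorus (Fin 3)))) tgForce ∧
      v ∈ Ideator2.mirrorSet ∧
      ∫ x, ‖((v : Lp (EuclideanSpace ℝ (Fin 3)) 2 (volume : Measure (UnitAddTorus (Fin 3)))) :
          UnitAddTorus (Fin 3) → EuclideanSpace ℝ (Fin 3)) x‖ ^ 2 ≤ E := by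
    intro j
    obtain ⟨ν, hν, hνlt, v, hV, hsol, heq, hK, hE⟩ := h (1 / ((j : ℝ) + 1)) (by positivity)
    exact ⟨ν, hν, hνlt, v, hV, hsol, heq, hK, hE⟩
  choose ν hν hνlt v hv using hch
  apply hB
  apply crux_of_steadyBranch'
  refine ⟨E, ν, v, hν, ?_, fun j => ⟨(hv j).1, (hv j).2.1, (hv j).2.2.1, (hv j).2.2.2.1, (hv j).2.2.2.2⟩⟩
  refine squeeze_zero (fun j => (hν j).le) (fun j => (hνlt j).le) ?_
  exact tendsto_one_div_add_atTop_nhds_zero_nat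

/-- **Injection split, leaf 1** (steady mirror states with bounded INJECTION at every `ν ∈ (0,1]`): `pairing v f_TG = ν‖∇v‖² ≤ W₀`. -/
def SteadyInjectionBoundedTG (W₀ : ℝ) : Prop :=
  ∀ ν : ℝ, 0 < ν → ν ≤ 1 → ∃ v : energySpace (Fin 3),
    ((v : Lp (EuclideanSpace ℝ (Fin 3)) 2 (volume : Measure (UnitAddTorus (Fin 3)))) ∈ energySpaceV (Fin 3)) ∧
    IsSteadyWeakSolution ν tgForce v ∧
    ν * (eGradNormSq ((v : Lp (EuclideanSpace ℝ (Fin 3)) 2 (volume : Measure (UnitAddTorus (Fin 3)))) :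
        UnitAddTorus (Fin 3) → EuclideanSpace ℝ (Fin 3))).toReal =
      pairing (v : Lp (EuclideanSpace ℝ (Fin 3)) 2 (volume : Measure (UnitAddTorus (Fin 3)))) tgForce ∧
    v ∈ Ideator2.mirrorSet ∧
    pairing (v : Lp (EuclideanSpace ℝ (Fin 3)) 2 (volume : Measure (UnitAddTorus (Fin 3)))) tgForce ≤ W₀

/-- **Injection split, leaf 2** (quiet-warm RIGIDITY of steady mirror states): below `ν = 1`, a steady mirror state whose injection is
`≤ W₀` has energy `≤ Φ`.  FALSE for every finite symmetric Galerkin truncation (the two-mode head–neck chain has injection `→ 0` and energy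
`→ ∞`), open for the PDE — census §D6. -/
def SteadyQuietWarmRigidityTG (W₀ Φ : ℝ) : Prop :=
  ∀ ν : ℝ, 0 < ν → ν ≤ 1 → ∀ v : energySpace (Fin 3),
    ((v : Lp (EuclideanSpace ℝ (Fin 3)) 2 (volume : Measure (UnitAddTorus (Fin 3)))) ∈ energySpaceV (Fin 3)) →
    IsSteadyWeakSolution ν tgForce v →
    ν * (eGradNormSq ((v : Lp (EuclideanSpace ℝ (Fin 3)) 2 (volume : Measure (UnitAddTorus (Fin 3)))) :
        UnitAddTorus (Fin 3) → EuclideanSpace ℝ (Fin 3))).toReal =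
      pairing (v : Lp (EuclideanSpace ℝ (Fin 3)) 2 (volume : Measure (UnitAddTorus (Fin 3)))) tgForce →
    v ∈ Ideator2.mirrorSet →
    pairing (v : Lp (EuclideanSpace ℝ (Fin 3)) 2 (volume : Measure (UnitAddTorus (Fin 3)))) tgForce ≤ W₀ →
    ∫ x, ‖((v : Lp (EuclideanSpace ℝ (Fin 3)) 2 (volume : Measure (UnitAddTorus (Fin 3)))) :
        UnitAddTorus (Fin 3) → EuclideanSpace ℝ (Fin 3)) x‖ ^ 2 ≤ Φ

/-- **Glue of the injection split, PROVED**: the two leaves give a bounded steady mirror branch along `ν_j = 1/(j+1)`. -/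
theorem steadyBranch_of_injectionSplit {W₀ Φ : ℝ} (h₁ : SteadyInjectionBoundedTG W₀) (h₂ : SteadyQuietWarmRigidityTG W₀ Φ) :
    Ideator2.SteadyMirrorBranchTG := by
  have hpos : ∀ j : ℕ, (0 : ℝ) < 1 / ((j : ℝ) + 1) := fun j => by positivity
  have hle : ∀ j : ℕ, 1 / ((j : ℝ) + 1) ≤ 1 := fun j => by
    rw [div_le_one (by positivity)]
    linarith [(Nat.cast_nonneg j : (0 : ℝ) ≤ j)]
  choose v hv using fun j : ℕ => h₁ (1 / ((j : ℝ) + 1)) (hpos j) (hle j)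
  refine ⟨Φ, fun j => 1 / ((j : ℝ) + 1), v, hpos, tendsto_one_div_add_atTop_nhds_zero_nat, fun j => ?_⟩
  obtain ⟨hV, hsol, heq, hK, hW⟩ := hv j
  exact ⟨hV, hsol, heq, hK, h₂ _ (hpos j) (hle j) (v j) hV hsol heq hK hW⟩

/-- The injection split composed to the crux. -/
theorem crux_of_injectionSplit {W₀ Φ : ℝ} (h₁ : SteadyInjectionBoundedTG W₀) (h₂ : SteadyQuietWarmRigidityTG W₀ Φ) : B :=
  crux_of_steadyBranch' (steadyBranch_of_injectionSplit h₁ h₂)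

/-! ## §4 The exponent ladder -/

/-- **Rung `α`**: some `K`-family with viscosities `≤ 1` has `ν_j^α · meanEnergy(u_j)` bounded.  `α = 0` is B_K, `α = 2` is the
a-priori (laminar) rung; every rung in between is open. -/
def ExponentBoundedMirrorFamily (α : ℝ) : Prop :=
  ∃ (C : ℝ) (ν : ℕ → ℝ) (u₀ : ℕ → UnitAddTorus (Fin 3) → EuclideanSpace ℝ (Fin 3))
    (u : ℕ → ℝ → UnitAddTorus (Fin 3) → EuclideanSpace ℝ (Fin 3)) (U : ℕ → ℝ → energySpace (Fin 3)),
    IsKFamily ν u₀ u U ∧ (∀ j, ν j ≤ 1) ∧ ∀ j, (ν j) ^ α * meanEnergy (u j) ≤ C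

/-- **B_K ↔ rung 0** (shift the family past the index where `ν_j ≤ 1`). -/
theorem crux_iff_exponent_zero : B ↔ ExponentBoundedMirrorFamily 0 := by
  constructor
  · intro hB
    obtain ⟨E, ν, u₀, u, U, hfam, hE⟩ := crux_iff.1 hB
    obtain ⟨J, hJ⟩ := Filter.eventually_atTop.1 (hfam.2.1.eventually (gt_mem_nhds (zero_lt_one' ℝ)))
    refine ⟨E, fun j => ν (j + J), fun j => u₀ (j + J), fun j => u (j + J), fun j => U (j + J), isKFamily_shift hfam J,
      fun j => (hJ (j + J) (Nat.le_add_left J j)).le, fun j => ?_⟩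
    rw [Real.rpow_zero, one_mul]
    exact hE (j + J)
  · rintro ⟨C, ν, u₀, u, U, hfam, -, hC⟩
    refine crux_iff.2 ⟨C, ν, u₀, u, U, hfam, fun j => ?_⟩
    have := hC j
    rwa [Real.rpow_zero, one_mul] at this

/-- **Monotonicity of the ladder**: `α ≤ β → rung α → rung β` (since `ν_j ≤ 1`). -/
theorem exponent_mono {α β : ℝ} (hαβ : α ≤ β) (h : ExponentBoundedMirrorFamily α) : ExponentBoundedMirrorFamily β := by
  obtain ⟨C, ν, u₀, u, U, hfam, hle, hC⟩ := h
  refine ⟨C, ν, u₀, u, U, hfam, hle, fun j => le_trans ?_ (hC j)⟩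
  exact mul_le_mul_of_nonneg_right (Real.rpow_le_rpow_of_exponent_ge (hfam.1 j) (hle j) hαβ) (meanEnergy_nonneg _)

/-- **The top rung `α = 2` is a theorem** (Part I `perViscosity_ceiling`: the `K`-symmetric rest solution at `ν_j = 1/(j+1)` has
`meanEnergy ≤ 2/ν_j²`). -/
theorem exponent_two : ExponentBoundedMirrorFamily 2 := by
  have hpos : ∀ j : ℕ, (0 : ℝ) < 1 / ((j : ℝ) + 1) := fun j => by positivity
  have hle : ∀ j : ℕ, 1 / ((j : ℝ) + 1) ≤ 1 := fun j => by
    rw [div_le_one (by positivity)]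
    linarith [(Nat.cast_nonneg j : (0 : ℝ) ≤ j)]
  choose u V hu using fun j : ℕ => perViscosity_ceiling (1 / ((j : ℝ) + 1)) (hpos j)
  refine ⟨2, fun j => 1 / ((j : ℝ) + 1), fun _ => 0, u, V,
    ⟨hpos, tendsto_one_div_add_atTop_nhds_zero_nat, fun j => (hu j).1, fun j => (hu j).2.1, fun j => (hu j).2.2.1⟩, hle,
    fun j => ?_⟩
  have hE := (hu j).2.2.2
  have hν := hpos j
  set ν := 1 / ((j : ℝ) + 1) with hνdef
  rw [Real.rpow_two]
  have hν2 : 0 < ν ^ 2 := by positivity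
  calc ν ^ 2 * meanEnergy (u j) ≤ ν ^ 2 * (2 / ν ^ 2) := mul_le_mul_of_nonneg_left hE hν2.le
    _ = 2 := by field_simp

end Summit.AnomalousDissipation.AnomalousDissipation.Cruxes.MirrorMeanBoundedFamilyTG.StrategyCensusR1

end
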